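import Mathlib

/-!
# Ventures/CertifiedManyBodySolver — Conjectures/SupportingLine.lean: STRUCTURE FACT **T-M1D.17** (supporting-line transfer of
# moment-relaxation certificates across fillings) and the convexity frame of **T-M1D.16**, TYPED AND PROVED ABSTRACTLY

HONEST FRAMING: first certified bounds; not a superconductivity verdict; every number certified or labelled float.

Source: `HOME/sr-mbsolver-m1-4/STRUCTURE-TM1-doped.md` v1.1 §B T-M1D.16 / T-M1D.17 (sr-mbsolver-m1-4 gen 9, 2026-08-23), tables
`structure/envelope/ENVELOPE.md` (sha16 f925477129e1fca5) and `structure/anat_dilute/TABLE-dilute-anatomy.md` (c806f9db471126a7).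

THE FACT (LP/SDP duality, one line). A certsdp certificate of a translation-invariant window moment relaxation `P` of the Hubbard
chain, taken at filling `n₀`, is an algebra identity `h − c·1 − Σσ λσ (nσ-word − (n₀/2)·1) = SOS + eom-part`; evaluated on ANY feasible
pseudo-state `ω` of `P` (in particular on the translation-averaged ground state of ANY filling `n`, whose energy per site is `e(n)`), the
right-hand side is `≥ 0`, so `E ω ≥ c + λ̄ (ρ ω − n₀)` with `λ̄ = (λ↑ + λ↓)/2` and `ρ ω` the filling of `ω`.  Hence every certificate is
a certified SUPPORTING LINE of the relaxation's value function `v_P(n) = inf {E ω : ρ ω = n}` and a fortiori of the true `e(n)`, at every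
filling; the maximum over certificates is a certified convex piecewise-linear minorant (`ENVELOPE.md`: 368 exact certificates, U = 1, 2, 4, 8).
THE FRAME of T-M1D.16: the feasible set of a moment relaxation is convex and `(ρ, E)` is linear on it, so `v_P` is convex in the filling —
the density multipliers `λ̄` read off successive certificates of one program are non-decreasing in `n` (dilute DS7/DS10 cells: `λ̄ = −2t` on
the blind segment `n·S₂ < 1`, a corner at the threshold, then rising towards the Lieb–Wu `μ`).

WHAT IS TYPED (abstract, no Hubbard-specific object is needed for the logic): a `Relaxation Ω` = a type of feasible pseudo-states with an
energy functional `E` and a filling functional `ρ`; a `LineCert` = numbers `(c, lam, n0)` with the certificate inequality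
`0 ≤ E ω − c − lam (ρ ω − n0)` for every feasible `ω` (this is exactly what reader A of certsdp/1 verifies, as an identity with a
sign-definite remainder); `Mixing` = closedness of the feasible set under convex combination as seen through `(ρ, E)`.
PROVED: `LineCert.line_le` (the line bounds every feasible energy), `line_le_value` (T-M1D.17: the line bounds the value function at EVERY
filling with a feasible point), `envelope_le_value` (finite envelopes), `value_convex` (T-M1D.16 frame: `v_P` is convex on fillings with
feasible points, given `Mixing` and one certificate for boundedness).  Nothing is asserted about the Hubbard chain itself: instantiating
`Ω` with the feasible moment functionals of a concrete program is the (routine) modelling step recorded in the STRUCTURE notes.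
-/

namespace Summit.Ventures.CertifiedManyBodySolver.Conjectures.SupportingLine

/-- An abstract moment relaxation: feasible pseudo-states `Ω` with an energy-per-site functional `E` and a filling functional `ρ`. -/
structure Relaxation (Ω : Type*) where
  E : Ω → ℝ
  ρ : Ω → ℝ

variable {Ω : Type*}

/-- A supporting-line certificate of `R` at filling `n0` with certified value `c` and density multiplier `lam`:
the certificate identity evaluated on any feasible pseudo-state leaves a non-negative remainder (SOS + eom part). -/
structure LineCert (R : Relaxation Ω) where
  c : ℝ
  lam : ℝ
  n0 : ℝ
  slack_nonneg : ∀ ω, 0 ≤ R.E ω - c - lam * (R.ρ ω - n0)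

/-- The value function of the relaxation at filling `n` (an `sInf` over the fibre; meaningful when the fibre is non-empty and
bounded below, which any certificate provides). -/
noncomputable def value (R : Relaxation Ω) (n : ℝ) : ℝ := sInf (R.E '' {ω | R.ρ ω = n})

/-- Closedness of the feasible set under convex combinations, as seen through `(ρ, E)`: for SDP moment relaxations take the convex
combination of the two moment functionals (it is feasible, its filling and energy are the convex combinations). -/
def Mixing (R : Relaxation Ω) : Prop :=
  ∀ ω₁ ω₂ : Ω, ∀ θ : ℝ, 0 ≤ θ → θ ≤ 1 →
    ∃ ω, R.ρ ω = θ * R.ρ ω₁ + (1 - θ) * R.ρ ω₂ ∧ R.E ω ≤ θ * R.E ω₁ + (1 - θ) * R.E ω₂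

variable {R : Relaxation Ω}

/-- The certificate's line bounds the energy of EVERY feasible pseudo-state, whatever its filling. -/
theorem LineCert.line_le (C : LineCert R) (ω : Ω) : C.c + C.lam * (R.ρ ω - C.n0) ≤ R.E ω := by
  have h := C.slack_nonneg ω
  linarith

/-- At the certificate's own filling the certified value itself is the bound. -/
theorem LineCert.le_of_filling (C : LineCert R) {ω : Ω} (h : R.ρ ω = C.n0) : C.c ≤ R.E ω := by
  have := C.line_le ω
  rw [h, sub_self, mul_zero, add_zero] at this
  exact this

/-- Any certificate makes every fibre of the value function bounded below. -/
theorem LineCert.bddBelow (C : LineCert R) (n : ℝ) : BddBelow (R.E '' {ω | R.ρ ω = n}) := by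
  refine ⟨C.c + C.lam * (n - C.n0), ?_⟩
  rintro _ ⟨ω, hω, rfl⟩
  have h := C.line_le ω
  have hρ : R.ρ ω = n := hω
  rw [hρ] at h
  exact h

/-- **T-M1D.17 (supporting-line transfer).** The certificate taken at filling `n0` bounds the relaxation's value — hence the true
ground-state energy per site, which is the energy of a feasible point — at EVERY filling `n` that has a feasible point:
`c + lam·(n − n0) ≤ v(n)`. -/
theorem line_le_value (C : LineCert R) {n : ℝ} (hne : ∃ ω, R.ρ ω = n) :
    C.c + C.lam * (n - C.n0) ≤ value R n := by
  unfold value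
  apply le_csInf
  · obtain ⟨ω, hω⟩ := hne
    exact ⟨R.E ω, ω, hω, rfl⟩
  · rintro _ ⟨ω, hω, rfl⟩
    have h := C.line_le ω
    have hρ : R.ρ ω = n := hω
    rw [hρ] at h
    exact h

/-- The envelope of finitely many certificates (the `ENVELOPE.md` construction) bounds the value at every filling. -/
theorem envelope_le_value {ι : Type*} (s : Finset ι) (hs : s.Nonempty) (C : ι → LineCert R) {n : ℝ}
    (hne : ∃ ω, R.ρ ω = n) :
    s.sup' hs (fun i => (C i).c + (C i).lam * (n - (C i).n0)) ≤ value R n := by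
  apply Finset.sup'_le
  intro i _
  exact line_le_value (C i) hne

/-- The value is attained from above: every feasible point of filling `n` bounds `v(n)` (needs one certificate for boundedness). -/
theorem value_le (C : LineCert R) {ω : Ω} {n : ℝ} (h : R.ρ ω = n) : value R n ≤ R.E ω := by
  unfold value
  exact csInf_le (C.bddBelow n) ⟨ω, h, rfl⟩

/-- **Frame of T-M1D.16 (convexity of the relaxation value in the filling).** If the feasible set is closed under convex
combination (`Mixing`) and some certificate exists, then on fillings that carry feasible points the value function is convex:
`v(θ n₁ + (1−θ) n₂) ≤ θ v(n₁) + (1−θ) v(n₂)`.  Consequently its one-sided slopes — the density multipliers of successive optimal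
certificates of one program — are non-decreasing in the filling. -/
theorem value_convex (hmix : Mixing R) (C : LineCert R) {n₁ n₂ θ : ℝ}
    (h₁ : ∃ ω, R.ρ ω = n₁) (h₂ : ∃ ω, R.ρ ω = n₂) (hθ₀ : 0 ≤ θ) (hθ₁ : θ ≤ 1) :
    value R (θ * n₁ + (1 - θ) * n₂) ≤ θ * value R n₁ + (1 - θ) * value R n₂ := by
  apply le_of_forall_pos_le_add
  intro ε hε
  have hne₁ : (R.E '' {ω | R.ρ ω = n₁}).Nonempty := by
    obtain ⟨ω, hω⟩ := h₁; exact ⟨R.E ω, ω, hω, rfl⟩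
  have hne₂ : (R.E '' {ω | R.ρ ω = n₂}).Nonempty := by
    obtain ⟨ω, hω⟩ := h₂; exact ⟨R.E ω, ω, hω, rfl⟩
  have hlt₁ : sInf (R.E '' {ω | R.ρ ω = n₁}) < value R n₁ + ε := by unfold value; linarith
  have hlt₂ : sInf (R.E '' {ω | R.ρ ω = n₂}) < value R n₂ + ε := by unfold value; linarith
  obtain ⟨_, ⟨ω₁, hω₁, rfl⟩, hE₁⟩ := exists_lt_of_csInf_lt hne₁ hlt₁
  obtain ⟨_, ⟨ω₂, hω₂, rfl⟩, hE₂⟩ := exists_lt_of_csInf_lt hne₂ hlt₂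
  have hρ₁ : R.ρ ω₁ = n₁ := hω₁
  have hρ₂ : R.ρ ω₂ = n₂ := hω₂
  obtain ⟨ω, hρ, hE⟩ := hmix ω₁ ω₂ θ hθ₀ hθ₁
  rw [hρ₁, hρ₂] at hρ
  have hv : value R (θ * n₁ + (1 - θ) * n₂) ≤ R.E ω := value_le C hρ
  have h1θ : 0 ≤ 1 - θ := by linarith
  have hb₁ : θ * R.E ω₁ ≤ θ * (value R n₁ + ε) := mul_le_mul_of_nonneg_left hE₁.le hθ₀
  have hb₂ : (1 - θ) * R.E ω₂ ≤ (1 - θ) * (value R n₂ + ε) := mul_le_mul_of_nonneg_left hE₂.le h1θ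
  nlinarith

end Summit.Ventures.CertifiedManyBodySolver.Conjectures.SupportingLine
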